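import Summits.CriticalPhenomena.PercolationContinuityZ3.Theorems.PercNearOneGluingNoHeavyLowerTailThreePointProductFormLeakDefs
import Summits.CriticalPhenomena.PercolationContinuityZ3.Theorems.PercNearOneGluingNoHeavyLowerTailThreePointProductFormCornersArc

/-!
# THEOREM N: a nonnegative (indeed integer) realisation of the 3-dimensional module of the box problem, and the
# cone laws it implies for every physical word (Sahi programme, prover prim-sahi-p2 gen 69)

Support file (`--supports stmt-CriticalPhenomena-4575`).  Standard axioms, no sorries, no named facts.  Memo
`run/shared/lean/prim/prim-sahi/FROM-prim-sahi-p2-gen69-MODULE-CONE.md`, `prim-sahi-p2/PROOF-E3.md` §79.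

THE OBJECT.  The AM form `A = #P1 + #P2 − 2·#bad` of the one-child boundary-star cycle (the "box theorem" programme of gens 63–68)
is the 12-state series `…ThreePointProductFormABPlus`; its nine middle states are `𝕄 ⊗ ℝ³` for ONE 3-dimensional module
`𝕄 = ⟨e1, e2, y⟩` (`ProductFormCorners.V3`, letters `ProductFormABPlus.actP/actQ/actR`, Krein form `betaM`; gens 65–66).  A physical child
with parameters `(u, w)`, `u, w ≥ 0`, acts by `M(s,d) = s²P + d²Q + sdR`, `s = u + w ≥ |d| = |u − w|` (`mSD` below; `mSD 1 x = ProductFormCorners.mX x`).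

THEOREM N (this file, exact):
* INTEGER REALISATION.  In the basis `B₀ = {(1,4,4), (1,4,−4), (−7,4,0)}` of `𝕄` the corner letters `M± = P + Q ± R` and `M₀ := P − Q` are the
  nonnegative INTEGER matrices `[[4,2,1],[0,1,0],[0,1,1]]`, `[[1,0,0],[2,4,1],[1,0,1]]`, `[[1,0,0],[0,1,0],[3,3,2]]` (`k0_mP`, `k0_mM`, `k0_mZ`), and
  `M(s,d) = u²M₊ + 2uw·M₀ + w²M₋` (`mSD_eq_corners`): every physical letter of `𝕄` is an entrywise-nonnegative matrix.
* THE CONE `K = cone{(3,0,2), (3,0,−2), (−9,4,0)} = {v : v.y ≥ 0, |v.z| ≤ (2/3)v.x + (3/2)v.y}` (coordinates `c1, c2, c3`) is mapped into itself by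
  every physical letter with STRICTLY positive matrix entries (`c_mSD`, `inK_mSD`, `inK_iterSD`), and the Krein form `β𝕄` is entrywise positive on its
  generators (`betaM_cone`), so `β𝕄(u,v) ≥ 0` for all `u, v ∈ K` (`betaM_nonneg_of_inK`, also for `−K`: `betaM_nonneg_of_negK`).
* CONE LAWS FOR EVERY PHYSICAL WORD (new reachability structure of the 12-dim automaton, `τ`-free and linear): the two `a`-part columns
  `col1 = (e₁′, e₂′, o₁)` and `col2 = (e₁″, e₂″, o₂)` of `brunA w omegaA` lie in `−K` for every physical word `w` (`cols_negK`), because their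
  `t`-proportional jumps do (`col1_bstepA`, `col2_bstepA`) and `t ≥ 0`.  Consequently the `n₊`-column `m₊ = (4·col1 + 3·col2)/32` of gen 66 lies
  in `−K` (`colP_negK`), and ALL Krein pairings among these columns of ANY two physical words are `≥ 0` (`betaM_cols_nonneg`) — e.g. the
  leading term `375·β𝕄(col₁, col₁′)` of the pair form `A[u ++ w]` (gen 66 `coeff_append_coords`) is nonnegative for every pair of words.
[this work] (gen 69).  The polyhedral NO-GO of the memo (§2: no polyhedral cone of the full 12-dim problem can certify the box theorem)
explains why these first-order laws cannot by themselves close the box theorem; they are inputs for the curved (S-procedure) certificates.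
-/

namespace Summit.CriticalPhenomena.PercolationContinuityZ3.Theorems.ProductFormModuleCone

open ProductFormCorners (V3 mX mP mM)
open ProductFormABPlus

/-! ## 1. The physical letter on `𝕄` and the integer realisation -/

/-- The physical letter `M(s,d) = s²·P + d²·Q + sd·R` on `𝕄 = ⟨e1,e2,y⟩` (column action; `s = u+w`, `d = u−w`). [this work] -/
def mSD (s d : ℚ) (v : V3) : V3 :=
  ⟨s ^ 2 * (-(5/2) * v.y) + d ^ 2 * ((3/4) * v.x + (37/16) * v.y) + s * d * v.z,
   s ^ 2 * (v.x + (15/4) * v.y),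
   s ^ 2 * ((5/4) * v.z) + d ^ 2 * ((1/4) * v.z) + s * d * ((3/4) * v.x + (37/16) * v.y)⟩

/-- `mSD` is `s²·actP + d²·actQ + sd·actR` (the letters of `…Krein`). [this work] -/
theorem mSD_eq_act (s d : ℚ) (v : V3) :
    mSD s d v = ⟨s ^ 2 * (actP v).x + d ^ 2 * (actQ v).x + s * d * (actR v).x,
      s ^ 2 * (actP v).y + d ^ 2 * (actQ v).y + s * d * (actR v).y,
      s ^ 2 * (actP v).z + d ^ 2 * (actQ v).z + s * d * (actR v).z⟩ := by
  ext <;> simp [mSD, actP, actQ, actR]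

/-- Normalised letters: `mSD 1 x` is the arc letter `mX x` of `…CornersArc` (hence `mSD 1 1 = M+`, `mSD 1 (−1) = M−`). [this work] -/
theorem mSD_one (x : ℚ) (v : V3) : mSD 1 x v = mX x v := by
  ext <;> simp [mSD, mX] <;> ring

/-- The mixed letter `M₀ := P − Q` on `𝕄`. [this work] -/
def mZ (v : V3) : V3 := ⟨(actP v).x - (actQ v).x, (actP v).y - (actQ v).y, (actP v).z - (actQ v).z⟩

/-- `M(s,d) = u²·M₊ + 2uw·M₀ + w²·M₋` with `u = (s+d)/2`, `w = (s−d)/2`. [this work] -/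
theorem mSD_eq_corners (s d : ℚ) (v : V3) :
    mSD s d v = ⟨((s + d) / 2) ^ 2 * (mP v).x + 2 * ((s + d) / 2) * ((s - d) / 2) * (mZ v).x + ((s - d) / 2) ^ 2 * (mM v).x,
      ((s + d) / 2) ^ 2 * (mP v).y + 2 * ((s + d) / 2) * ((s - d) / 2) * (mZ v).y + ((s - d) / 2) ^ 2 * (mM v).y,
      ((s + d) / 2) ^ 2 * (mP v).z + 2 * ((s + d) / 2) * ((s - d) / 2) * (mZ v).z + ((s - d) / 2) ^ 2 * (mM v).z⟩ := by
  ext <;> simp [mSD, mP, mM, mZ, actP, actQ] <;> ring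

/-- Coordinates with respect to the integer basis `B₀ = {(1,4,4), (1,4,−4), (−7,4,0)}`: first coordinate. [this work] -/
def k01 (v : V3) : ℚ := v.x / 16 + 7 * v.y / 64 + v.z / 8
/-- Second `B₀`-coordinate. [this work] -/
def k02 (v : V3) : ℚ := v.x / 16 + 7 * v.y / 64 - v.z / 8
/-- Third `B₀`-coordinate. [this work] -/
def k03 (v : V3) : ℚ := -(v.x / 8) + v.y / 32

/-- `B₀` is a basis: `v = k01·(1,4,4) + k02·(1,4,−4) + k03·(−7,4,0)`. [this work] -/
theorem recon0 (v : V3) :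
    v = ⟨k01 v + k02 v - 7 * k03 v, 4 * k01 v + 4 * k02 v + 4 * k03 v, 4 * k01 v - 4 * k02 v⟩ := by
  ext <;> simp [k01, k02, k03] <;> ring

/-- INTEGER REALISATION, `M₊`: in `B₀` the corner letter `M+` is `[[4,2,1],[0,1,0],[0,1,1]]`. [this work] -/
theorem k0_mP (v : V3) :
    k01 (mP v) = 4 * k01 v + 2 * k02 v + k03 v ∧ k02 (mP v) = k02 v ∧ k03 (mP v) = k02 v + k03 v := by
  refine ⟨?_, ?_, ?_⟩ <;> simp [k01, k02, k03, mP] <;> ring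

/-- INTEGER REALISATION, `M₋`: in `B₀` the corner letter `M−` is `[[1,0,0],[2,4,1],[1,0,1]]`. [this work] -/
theorem k0_mM (v : V3) :
    k01 (mM v) = k01 v ∧ k02 (mM v) = 2 * k01 v + 4 * k02 v + k03 v ∧ k03 (mM v) = k01 v + k03 v := by
  refine ⟨?_, ?_, ?_⟩ <;> simp [k01, k02, k03, mM] <;> ring

/-- INTEGER REALISATION, `M₀ = P − Q`: in `B₀` it is `[[1,0,0],[0,1,0],[3,3,2]]`. [this work] -/
theorem k0_mZ (v : V3) :
    k01 (mZ v) = k01 v ∧ k02 (mZ v) = k02 v ∧ k03 (mZ v) = 3 * k01 v + 3 * k02 v + 2 * k03 v := by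
  refine ⟨?_, ?_, ?_⟩ <;> simp [k01, k02, k03, mZ, actP, actQ] <;> ring

/-! ## 2. The strictly invariant cone `K = cone{(3,0,2), (3,0,−2), (−9,4,0)}` -/

/-- First `K`-coordinate `c1 = x/6 + 3y/8 + z/4` (coefficient of `(3,0,2)`). [this work] -/
def c1 (v : V3) : ℚ := v.x / 6 + 3 * v.y / 8 + v.z / 4
/-- Second `K`-coordinate `c2 = x/6 + 3y/8 − z/4` (coefficient of `(3,0,−2)`). [this work] -/
def c2 (v : V3) : ℚ := v.x / 6 + 3 * v.y / 8 - v.z / 4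
/-- Third `K`-coordinate `c3 = y/4` (coefficient of `(−9,4,0)`). [this work] -/
def c3 (v : V3) : ℚ := v.y / 4

/-- `K`-basis reconstruction: `v = c1·(3,0,2) + c2·(3,0,−2) + c3·(−9,4,0)`. [this work] -/
theorem recon (v : V3) : v = ⟨3 * c1 v + 3 * c2 v - 9 * c3 v, 4 * c3 v, 2 * c1 v - 2 * c2 v⟩ := by
  ext <;> simp [c1, c2, c3] <;> ring

/-- Membership in `K` (`= {y ≥ 0, |z| ≤ (2/3)x + (3/2)y}`). [this work] -/
def inK (v : V3) : Prop := 0 ≤ c1 v ∧ 0 ≤ c2 v ∧ 0 ≤ c3 v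

/-- Membership in `−K`. [this work] -/
def negK (v : V3) : Prop := c1 v ≤ 0 ∧ c2 v ≤ 0 ∧ c3 v ≤ 0

/-- The matrix of `M(s,d)` in `K`-coordinates, first row: every entry is a nonnegative combination of `(s+d)²`, `(s−d)²`, `(s+d)(s−d)`. [this work] -/
theorem c1_mSD (s d : ℚ) (v : V3) : c1 (mSD s d v) =
    ((s + d) ^ 2 * (151/192) + (s - d) ^ 2 * (65/192) + (s + d) * (s - d) * (5/8)) * c1 v
    + ((s + d) ^ 2 * (47/192) + (s - d) ^ 2 * (25/192) + (s + d) * (s - d) * (1/8)) * c2 v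
    + ((s + d) ^ 2 * (13/32) + (s - d) ^ 2 * (3/32) + (s + d) * (s - d) * (1/12)) * c3 v := by
  simp only [c1, c2, c3, mSD]; ring

/-- Second row of `M(s,d)` in `K`-coordinates (the `(s+d) ↔ (s−d)` mirror of the first). [this work] -/
theorem c2_mSD (s d : ℚ) (v : V3) : c2 (mSD s d v) =
    ((s + d) ^ 2 * (25/192) + (s - d) ^ 2 * (47/192) + (s + d) * (s - d) * (1/8)) * c1 v
    + ((s + d) ^ 2 * (65/192) + (s - d) ^ 2 * (151/192) + (s + d) * (s - d) * (5/8)) * c2 v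
    + ((s + d) ^ 2 * (3/32) + (s - d) ^ 2 * (13/32) + (s + d) * (s - d) * (1/12)) * c3 v := by
  simp only [c1, c2, c3, mSD]; ring

/-- Third row of `M(s,d)` in `K`-coordinates. [this work] -/
theorem c3_mSD (s d : ℚ) (v : V3) : c3 (mSD s d v) =
    ((s + d) ^ 2 * (3/16) + (s - d) ^ 2 * (3/16) + (s + d) * (s - d) * (3/8)) * c1 v
    + ((s + d) ^ 2 * (3/16) + (s - d) ^ 2 * (3/16) + (s + d) * (s - d) * (3/8)) * c2 v
    + ((s + d) ^ 2 * (3/8) + (s - d) ^ 2 * (3/8) + (s + d) * (s - d) * (3/4)) * c3 v := by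
  simp only [c1, c2, c3, mSD]; ring

/-- THEOREM N (cone form): every physical letter (`|d| ≤ s`) maps `K` into `K`. [this work] -/
theorem inK_mSD (s d : ℚ) (hp : 0 ≤ s + d) (hm : 0 ≤ s - d) {v : V3} (hv : inK v) : inK (mSD s d v) := by
  obtain ⟨h1, h2, h3⟩ := hv
  have hpm : 0 ≤ (s + d) * (s - d) := mul_nonneg hp hm
  have hp2 : 0 ≤ (s + d) ^ 2 := sq_nonneg _
  have hm2 : 0 ≤ (s - d) ^ 2 := sq_nonneg _
  refine ⟨?_, ?_, ?_⟩
  · rw [c1_mSD]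
    have := mul_nonneg hp2 h1; have := mul_nonneg hm2 h1; have := mul_nonneg hpm h1
    have := mul_nonneg hp2 h2; have := mul_nonneg hm2 h2; have := mul_nonneg hpm h2
    have := mul_nonneg hp2 h3; have := mul_nonneg hm2 h3; have := mul_nonneg hpm h3
    nlinarith
  · rw [c2_mSD]
    have := mul_nonneg hp2 h1; have := mul_nonneg hm2 h1; have := mul_nonneg hpm h1
    have := mul_nonneg hp2 h2; have := mul_nonneg hm2 h2; have := mul_nonneg hpm h2
    have := mul_nonneg hp2 h3; have := mul_nonneg hm2 h3; have := mul_nonneg hpm h3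
    nlinarith
  · rw [c3_mSD]
    have := mul_nonneg hp2 h1; have := mul_nonneg hm2 h1; have := mul_nonneg hpm h1
    have := mul_nonneg hp2 h2; have := mul_nonneg hm2 h2; have := mul_nonneg hpm h2
    have := mul_nonneg hp2 h3; have := mul_nonneg hm2 h3; have := mul_nonneg hpm h3
    nlinarith

/-- Mirror statement: every physical letter maps `−K` into `−K`. [this work] -/
theorem negK_mSD (s d : ℚ) (hp : 0 ≤ s + d) (hm : 0 ≤ s - d) {v : V3} (hv : negK v) : negK (mSD s d v) := by
  obtain ⟨h1, h2, h3⟩ := hv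
  have hpm : 0 ≤ (s + d) * (s - d) := mul_nonneg hp hm
  have hp2 : 0 ≤ (s + d) ^ 2 := sq_nonneg _
  have hm2 : 0 ≤ (s - d) ^ 2 := sq_nonneg _
  refine ⟨?_, ?_, ?_⟩
  · rw [c1_mSD]
    have := mul_nonpos_iff.mpr (Or.inl ⟨hp2, h1⟩); have := mul_nonpos_iff.mpr (Or.inl ⟨hm2, h1⟩)
    have := mul_nonpos_iff.mpr (Or.inl ⟨hpm, h1⟩); have := mul_nonpos_iff.mpr (Or.inl ⟨hp2, h2⟩)
    have := mul_nonpos_iff.mpr (Or.inl ⟨hm2, h2⟩); have := mul_nonpos_iff.mpr (Or.inl ⟨hpm, h2⟩)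
    have := mul_nonpos_iff.mpr (Or.inl ⟨hp2, h3⟩); have := mul_nonpos_iff.mpr (Or.inl ⟨hm2, h3⟩)
    have := mul_nonpos_iff.mpr (Or.inl ⟨hpm, h3⟩)
    nlinarith
  · rw [c2_mSD]
    have := mul_nonpos_iff.mpr (Or.inl ⟨hp2, h1⟩); have := mul_nonpos_iff.mpr (Or.inl ⟨hm2, h1⟩)
    have := mul_nonpos_iff.mpr (Or.inl ⟨hpm, h1⟩); have := mul_nonpos_iff.mpr (Or.inl ⟨hp2, h2⟩)
    have := mul_nonpos_iff.mpr (Or.inl ⟨hm2, h2⟩); have := mul_nonpos_iff.mpr (Or.inl ⟨hpm, h2⟩)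
    have := mul_nonpos_iff.mpr (Or.inl ⟨hp2, h3⟩); have := mul_nonpos_iff.mpr (Or.inl ⟨hm2, h3⟩)
    have := mul_nonpos_iff.mpr (Or.inl ⟨hpm, h3⟩)
    nlinarith
  · rw [c3_mSD]
    have := mul_nonpos_iff.mpr (Or.inl ⟨hp2, h1⟩); have := mul_nonpos_iff.mpr (Or.inl ⟨hm2, h1⟩)
    have := mul_nonpos_iff.mpr (Or.inl ⟨hpm, h1⟩); have := mul_nonpos_iff.mpr (Or.inl ⟨hp2, h2⟩)
    have := mul_nonpos_iff.mpr (Or.inl ⟨hm2, h2⟩); have := mul_nonpos_iff.mpr (Or.inl ⟨hpm, h2⟩)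
    have := mul_nonpos_iff.mpr (Or.inl ⟨hp2, h3⟩); have := mul_nonpos_iff.mpr (Or.inl ⟨hm2, h3⟩)
    have := mul_nonpos_iff.mpr (Or.inl ⟨hpm, h3⟩)
    nlinarith

/-- A word of physical letters `[(s₁,d₁), …]` acting on `𝕄` (head letter acts last, as `brunA`). [this work] -/
def iterSD : List (ℚ × ℚ) → V3 → V3
  | [], v => v
  | θ :: w, v => mSD θ.1 θ.2 (iterSD w v)

/-- Every product of physical letters maps `K` into `K`. [this work] -/
theorem inK_iterSD (w : List (ℚ × ℚ)) (hw : ∀ θ ∈ w, 0 ≤ θ.1 + θ.2 ∧ 0 ≤ θ.1 - θ.2) {v : V3} (hv : inK v) :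
    inK (iterSD w v) := by
  induction w with
  | nil => simpa [iterSD] using hv
  | cons θ w ih =>
    have hθ := hw θ (by simp)
    have hw' : ∀ θ' ∈ w, 0 ≤ θ'.1 + θ'.2 ∧ 0 ≤ θ'.1 - θ'.2 := fun θ' h => hw θ' (by simp [h])
    simpa [iterSD] using inK_mSD θ.1 θ.2 hθ.1 hθ.2 (ih hw')

/-- The Krein form `β𝕄` of `…Krein` in `K`-coordinates: Gram matrix `[[43/4, 11/4, 15/2], [11/4, 43/4, 15/2], [15/2, 15/2, 3]]` of the
generators — all entries positive (`K` is a `β𝕄`-acute cone). [this work] -/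
theorem betaM_cone (u v : V3) : betaM u v =
    (43/4) * (c1 u * c1 v) + (11/4) * (c1 u * c2 v + c2 u * c1 v) + (15/2) * (c1 u * c3 v + c3 u * c1 v)
    + (43/4) * (c2 u * c2 v) + (15/2) * (c2 u * c3 v + c3 u * c2 v) + 3 * (c3 u * c3 v) := by
  simp only [betaM, c1, c2, c3]; ring

/-- Two vectors of `K` pair nonnegatively under `β𝕄`. [this work] -/
theorem betaM_nonneg_of_inK {u v : V3} (hu : inK u) (hv : inK v) : 0 ≤ betaM u v := by
  obtain ⟨a1, a2, a3⟩ := hu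
  obtain ⟨e1, e2, e3⟩ := hv
  rw [betaM_cone]
  have := mul_nonneg a1 e1; have := mul_nonneg a1 e2; have := mul_nonneg a1 e3
  have := mul_nonneg a2 e1; have := mul_nonneg a2 e2; have := mul_nonneg a2 e3
  have := mul_nonneg a3 e1; have := mul_nonneg a3 e2; have := mul_nonneg a3 e3
  nlinarith

/-- Two vectors of `−K` pair nonnegatively under `β𝕄`. [this work] -/
theorem betaM_nonneg_of_negK {u v : V3} (hu : negK u) (hv : negK v) : 0 ≤ betaM u v := by
  obtain ⟨a1, a2, a3⟩ := hu
  obtain ⟨e1, e2, e3⟩ := hv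
  rw [betaM_cone]
  have := mul_nonneg_of_nonpos_of_nonpos a1 e1; have := mul_nonneg_of_nonpos_of_nonpos a1 e2
  have := mul_nonneg_of_nonpos_of_nonpos a1 e3; have := mul_nonneg_of_nonpos_of_nonpos a2 e1
  have := mul_nonneg_of_nonpos_of_nonpos a2 e2; have := mul_nonneg_of_nonpos_of_nonpos a2 e3
  have := mul_nonneg_of_nonpos_of_nonpos a3 e1; have := mul_nonneg_of_nonpos_of_nonpos a3 e2
  have := mul_nonneg_of_nonpos_of_nonpos a3 e3
  nlinarith

/-! ## 3. Cone laws for the columns of the 12-state automaton along every physical word -/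

/-- The `U¹`-column `col1 = (e₁′, e₂′, o₁)` of an `a`-state (the column the leak reads, gen 66). [this work] -/
def col1 (v : StA) : V3 := ⟨v.e1a, v.e2a, v.o1⟩

/-- The `U²`-column `col2 = (e₁″, e₂″, o₂)` of an `a`-state. [this work] -/
def col2 (v : StA) : V3 := ⟨v.e1b, v.e2b, v.o2⟩

/-- `col1` moves by `M(s,d)` plus the `t`-proportional jump `(−(3/640)s² − (9/128)d², −(3/160)s² + (3/160)d², −(3/80)sd)`. [this work] -/
theorem col1_bstepA (s d : ℚ) (v : StA) : col1 (bstepA s d v) =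
    ⟨(mSD s d (col1 v)).x + v.t * (-(3/640) * s ^ 2 - (9/128) * d ^ 2),
     (mSD s d (col1 v)).y + v.t * (-(3/160) * s ^ 2 + (3/160) * d ^ 2),
     (mSD s d (col1 v)).z + v.t * (-(3/80) * (s * d))⟩ := by
  ext <;> simp [col1, bstepA, combA, stepA, mSD] <;> ring

/-- `col2` moves by `M(s,d)` plus the `t`-proportional jump `((−3s² + 59d²)/800, (−12s² − 20d²)/800, 0)`. [this work] -/
theorem col2_bstepA (s d : ℚ) (v : StA) : col2 (bstepA s d v) =
    ⟨(mSD s d (col2 v)).x + v.t * ((-3 * s ^ 2 + 59 * d ^ 2) / 800),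
     (mSD s d (col2 v)).y + v.t * ((-12 * s ^ 2 - 20 * d ^ 2) / 800),
     (mSD s d (col2 v)).z⟩ := by
  ext <;> simp [col2, bstepA, combA, stepA, mSD] <;> ring

/-- The `t`-coordinate is multiplied by `(3s² + d²)/4 ≥ 0`. [this work] -/
theorem t_bstepA (s d : ℚ) (v : StA) : (bstepA s d v).t = ((3 * s ^ 2 + d ^ 2) / 4) * v.t := by
  simp [bstepA, combA, stepA]; ring

/-- One physical step preserves `col1 ∈ −K`, given `t ≥ 0`: the jump has `K`-coordinates
`−(2s² + 3(s+d)²)/640`, `−(2s² + 3(s−d)²)/640`, `−(3/640)(s+d)(s−d)`, all `≤ 0`. [this work] -/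
theorem col1_negK_step (s d : ℚ) (hp : 0 ≤ s + d) (hm : 0 ≤ s - d) {v : StA} (ht : 0 ≤ v.t)
    (hv : negK (col1 v)) : negK (col1 (bstepA s d v)) := by
  have hK := negK_mSD s d hp hm hv
  obtain ⟨g1, g2, g3⟩ := hK
  have e1 : c1 (col1 (bstepA s d v)) = c1 (mSD s d (col1 v)) - v.t * ((2 * s ^ 2 + 3 * (s + d) ^ 2) / 640) := by
    rw [col1_bstepA]; simp only [c1]; ring
  have e2 : c2 (col1 (bstepA s d v)) = c2 (mSD s d (col1 v)) - v.t * ((2 * s ^ 2 + 3 * (s - d) ^ 2) / 640) := by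
    rw [col1_bstepA]; simp only [c2]; ring
  have e3 : c3 (col1 (bstepA s d v)) = c3 (mSD s d (col1 v)) - v.t * ((3/640) * ((s + d) * (s - d))) := by
    rw [col1_bstepA]; simp only [c3]; ring
  refine ⟨?_, ?_, ?_⟩
  · rw [e1]; nlinarith [mul_nonneg ht (by positivity : (0:ℚ) ≤ (2 * s ^ 2 + 3 * (s + d) ^ 2) / 640)]
  · rw [e2]; nlinarith [mul_nonneg ht (by positivity : (0:ℚ) ≤ (2 * s ^ 2 + 3 * (s - d) ^ 2) / 640)]
  · rw [e3]
    have : (0:ℚ) ≤ (3/640) * ((s + d) * (s - d)) := by positivity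
    nlinarith [mul_nonneg ht this]

/-- One physical step preserves `col2 ∈ −K`, given `t ≥ 0`: the jump has `K`-coordinates
`−(15s² − 7d²)/2400` (twice) and `−(3s² + 5d²)/800`, all `≤ 0` when `|d| ≤ s`. [this work] -/
theorem col2_negK_step (s d : ℚ) (hp : 0 ≤ s + d) (hm : 0 ≤ s - d) {v : StA} (ht : 0 ≤ v.t)
    (hv : negK (col2 v)) : negK (col2 (bstepA s d v)) := by
  have hK := negK_mSD s d hp hm hv
  obtain ⟨g1, g2, g3⟩ := hK
  have hsd : 0 ≤ (s + d) * (s - d) := mul_nonneg hp hm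
  have e1 : c1 (col2 (bstepA s d v)) = c1 (mSD s d (col2 v)) - v.t * ((8 * s ^ 2 + 7 * ((s + d) * (s - d))) / 2400) := by
    rw [col2_bstepA]; simp only [c1]; ring
  have e2 : c2 (col2 (bstepA s d v)) = c2 (mSD s d (col2 v)) - v.t * ((8 * s ^ 2 + 7 * ((s + d) * (s - d))) / 2400) := by
    rw [col2_bstepA]; simp only [c2]; ring
  have e3 : c3 (col2 (bstepA s d v)) = c3 (mSD s d (col2 v)) - v.t * ((3 * s ^ 2 + 5 * d ^ 2) / 800) := by
    rw [col2_bstepA]; simp only [c3]; ring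
  have hj : (0:ℚ) ≤ (8 * s ^ 2 + 7 * ((s + d) * (s - d))) / 2400 := by positivity
  refine ⟨?_, ?_, ?_⟩
  · rw [e1]; nlinarith [mul_nonneg ht hj]
  · rw [e2]; nlinarith [mul_nonneg ht hj]
  · rw [e3]; nlinarith [mul_nonneg ht (by positivity : (0:ℚ) ≤ (3 * s ^ 2 + 5 * d ^ 2) / 800)]

/-- LAW C (cone law): along every physical word from `ω`, `t ≥ 0` and both columns `col1`, `col2` stay in `−K`. [this work] -/
theorem cols_negK (w : List (ℚ × ℚ)) (hw : ∀ θ ∈ w, 0 ≤ θ.1 + θ.2 ∧ 0 ≤ θ.1 - θ.2) :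
    0 ≤ (brunA w omegaA).t ∧ negK (col1 (brunA w omegaA)) ∧ negK (col2 (brunA w omegaA)) := by
  induction w with
  | nil =>
    refine ⟨by norm_num [brunA, omegaA], ?_, ?_⟩ <;>
      (refine ⟨?_, ?_, ?_⟩ <;> norm_num [brunA, omegaA, col1, col2, c1, c2, c3])
  | cons θ w ih =>
    have hθ := hw θ (by simp)
    have hw' : ∀ θ' ∈ w, 0 ≤ θ'.1 + θ'.2 ∧ 0 ≤ θ'.1 - θ'.2 := fun θ' h => hw θ' (by simp [h])
    obtain ⟨ht, h1, h2⟩ := ih hw'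
    refine ⟨?_, ?_, ?_⟩
    · show 0 ≤ (bstepA θ.1 θ.2 (brunA w omegaA)).t
      rw [t_bstepA]; positivity
    · exact col1_negK_step θ.1 θ.2 hθ.1 hθ.2 ht h1
    · exact col2_negK_step θ.1 θ.2 hθ.1 hθ.2 ht h2

/-- `negK` is closed under nonnegative combinations. [this work] -/
theorem negK_comb {u v : V3} (a b : ℚ) (ha : 0 ≤ a) (hb : 0 ≤ b) (hu : negK u) (hv : negK v) :
    negK ⟨a * u.x + b * v.x, a * u.y + b * v.y, a * u.z + b * v.z⟩ := by
  obtain ⟨u1, u2, u3⟩ := hu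
  obtain ⟨v1, v2, v3⟩ := hv
  refine ⟨?_, ?_, ?_⟩
  · have e : c1 ⟨a * u.x + b * v.x, a * u.y + b * v.y, a * u.z + b * v.z⟩ = a * c1 u + b * c1 v := by
      simp only [c1]; ring
    rw [e]; nlinarith [mul_nonpos_iff.mpr (Or.inl ⟨ha, u1⟩), mul_nonpos_iff.mpr (Or.inl ⟨hb, v1⟩)]
  · have e : c2 ⟨a * u.x + b * v.x, a * u.y + b * v.y, a * u.z + b * v.z⟩ = a * c2 u + b * c2 v := by
      simp only [c2]; ring
    rw [e]; nlinarith [mul_nonpos_iff.mpr (Or.inl ⟨ha, u2⟩), mul_nonpos_iff.mpr (Or.inl ⟨hb, v2⟩)]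
  · have e : c3 ⟨a * u.x + b * v.x, a * u.y + b * v.y, a * u.z + b * v.z⟩ = a * c3 u + b * c3 v := by
      simp only [c3]; ring
    rw [e]; nlinarith [mul_nonpos_iff.mpr (Or.inl ⟨ha, u3⟩), mul_nonpos_iff.mpr (Or.inl ⟨hb, v3⟩)]

/-- The `n₊`-column `m₊ = (4·col1 + 3·col2)/32` of gen 66 (`colP` of `…Krein`) lies in `−K` along every physical word. [this work] -/
theorem colP_negK (w : List (ℚ × ℚ)) (hw : ∀ θ ∈ w, 0 ≤ θ.1 + θ.2 ∧ 0 ≤ θ.1 - θ.2) :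
    negK (colP (brunA w omegaA)) := by
  obtain ⟨_, h1, h2⟩ := cols_negK w hw
  have h := negK_comb (4/32 : ℚ) (3/32 : ℚ) (by norm_num) (by norm_num) h1 h2
  have e : colP (brunA w omegaA) = ⟨(4/32 : ℚ) * (col1 (brunA w omegaA)).x + (3/32 : ℚ) * (col2 (brunA w omegaA)).x,
      (4/32 : ℚ) * (col1 (brunA w omegaA)).y + (3/32 : ℚ) * (col2 (brunA w omegaA)).y,
      (4/32 : ℚ) * (col1 (brunA w omegaA)).z + (3/32 : ℚ) * (col2 (brunA w omegaA)).z⟩ := by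
    ext <;> simp [colP, col1, col2] <;> ring
  rw [e]; exact h

/-- All Krein pairings among the columns `col1`, `col2` of ANY two physical words are nonnegative; in particular the leading
term `375·β𝕄(col₁, col₁′)` of the pair form of gen 66 is `≥ 0` for every pair of physical words. [this work] -/
theorem betaM_cols_nonneg (u w : List (ℚ × ℚ)) (hu : ∀ θ ∈ u, 0 ≤ θ.1 + θ.2 ∧ 0 ≤ θ.1 - θ.2)
    (hw : ∀ θ ∈ w, 0 ≤ θ.1 + θ.2 ∧ 0 ≤ θ.1 - θ.2) :
    0 ≤ betaM (col1 (brunA u omegaA)) (col1 (brunA w omegaA)) ∧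
    0 ≤ betaM (col1 (brunA u omegaA)) (col2 (brunA w omegaA)) ∧
    0 ≤ betaM (col2 (brunA u omegaA)) (col2 (brunA w omegaA)) ∧
    0 ≤ betaM (colP (brunA u omegaA)) (colP (brunA w omegaA)) := by
  obtain ⟨_, hu1, hu2⟩ := cols_negK u hu
  obtain ⟨_, hw1, hw2⟩ := cols_negK w hw
  exact ⟨betaM_nonneg_of_negK hu1 hw1, betaM_nonneg_of_negK hu1 hw2, betaM_nonneg_of_negK hu2 hw2,
    betaM_nonneg_of_negK (colP_negK u hu) (colP_negK w hw)⟩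

end Summit.CriticalPhenomena.PercolationContinuityZ3.Theorems.ProductFormModuleCone
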